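import Summits.BirchSwinnertonDyer.Rank1Residual.JET.CarrierReadingRecordsKitThree
import Summits.BirchSwinnertonDyer.BirchSwinnertonDyer.Theorems.Rank1ResidualJetCarrierNeKitThree
import Summits.BirchSwinnertonDyer.BirchSwinnertonDyer.Theorems.Rank1ResidualJetRecordsKitSwapNe
import HarnessLib

/-!
# T1 JET (cell `bsd-jet`), bucket A at `p = 3`: the last four ROW KITS re-keyed to NAMED PRINT ONLY —
# `bsdp_of_jetRowCarrierNe_three_of_frobenius`, `bsdp_of_jetRowA3F_tamX_min` (road F), `bsdp_of_jetRowA3_tam_min` /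
# `_tamX_min` (`3` multiplicative at `3`, carrier `q ≠ 3`) with `hJ`, `hMcU`, McCallum 5.2, `hrec`, `hD36`, `hlev` FED BY NAME

HONEST FRAMING (programme file `BSD-LIT2PART-PROGRAMME-v1.md` §HONESTY, verbatim): «no tranche here
proves BSD; ARM L moves the LITERAL column of an r ≤ 1 census into the kernel-proved-modulo-named-print
column; ARM P changes what «named print» is worth.» THEOREMS ONLY (seat `bsd-jet-pv-2`, session g7;
`--supports stmt-BirchSwinnertonDyer-14418`, helper); nothing is booked by this file (bookings are referee
A's; the JET@p∣N rows of record stand on the documentary strikes R409/R466/R516–R518); 0 classes move.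

WHAT. Completes the re-keying of every ROW KIT the landed by-name JET records call (`Rank1ResidualJetRecordsKitSwap`
p567356: A5/B5; `…KitSwapThree` p568451: A3F/B3/CarrierAdd at 3; `…KitSwapNe`: pv-1's bucket-A literal-model kits +
the `_level_of_mult` / `_of_irr_of_ram` / `_three_of_frobenius` consumer shapes; `…KitSwapMult`: bucket-B
multiplicative literal-model kits). Here: §0 the `_level_three_of_frobenius` consumer shape (tower from ONE mod-9 Frobenius witness) as an
`…_of_swapLiterature` form + pv-1's `bsdp_of_jetRowCarrierNe_three_of_frobenius` (`Theorems/Rank1ResidualJetCarrierNeKitThree` :245) on it;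
§1 `bsdp_of_jetRowA3F_tamX_min` (`JET/CarrierReadingRecordsKitThree` :145;
road F with an exact stage-2 `TamX` certificate at an additive IV/IV* carrier) → `…Ne…_level_of_swapLiterature` with
the mod-9 tower; `bsdp_of_jetRowA3_tam_min` / `_tamX_min` (`JET/CarrierReadingRecordsKit` :226 / :286; `3`
multiplicative at `3`, carrier `q ≠ 3`) → `…Ne…_level_of_mult_of_swapLiterature`. Numeric front ends VERBATIM;
displayed class-free binders EXACTLY {`hPT` (∀ K), `hF1`, `h372`, `hGZK`, `hKo` (∀), `hmod`}. References: [cite: Jetchev2008, Cor. 1.5 (p. 812)]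
[cite: Serre1972, §2.4 Prop. 15] [cite: SerreAbelianLadic1968, Ch. IV §3.4 Lemma 3] [cite: SilvermanATAEC1994, IV.9.4 Steps 5 and 8]
[cite: Wuthrich2014, Lemma 20 (p. 399)]. Design: no definitions. Axioms: `propext`, `Classical.choice`, `Quot.sound`.
-/

set_option autoImplicit false

noncomputable section

open scoped Classical

open WeierstrassCurve Literature.NumberTheory.EllipticCurves
  Literature.NumberTheory.EllipticCurves.ModularForms Literature.NumberTheory.GaloisCohomology
  Literature.NumberTheory.EllipticCurves.Rank1Residual
  Literature.NumberTheory.EllipticCurves.Rank1Residual.Typed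
  Literature.NumberTheory.EllipticCurves.Rank1Residual.X11RankOneCertificates
  Summit.BirchSwinnertonDyer.BirchSwinnertonDyer.Rank1Residual
  Summit.BirchSwinnertonDyer.BirchSwinnertonDyer.Rank1Residual.IntModel
  Summit.BirchSwinnertonDyer.BirchSwinnertonDyer.Rank1Residual.X11RankOne
  Summit.BirchSwinnertonDyer.BirchSwinnertonDyer.Rank2Observatory.Tam
  Summit.BirchSwinnertonDyer.Rank1Residual Summit.BirchSwinnertonDyer.Rank1Residual.X11b

namespace Summit.BirchSwinnertonDyer.Rank1Residual.JET

/-! ## §0 The `p = 3` Frobenius-tower LEVEL consumer shape and pv-1's literal-model kit on it -/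

/-- **Bucket A at level `N`, `p = 3`, ANY reduction at `3`, `ρ̄_{E,3}` onto + ONE mod-`9` Frobenius
witness ⟸ named print only** — the shape of `JET.bsdp_of_carrierNeCertificate_level_three_of_frobenius`:
the `3`-adic tower by `WeierstrassCurve.forall_hasSurjectiveModNGaloisRep_three_pow_of_frobenius`, then
`bsdp_of_carrierNeCertificate_level_of_swapLiterature`. Displayed: {`hPT`, `hF1`, `h372`, `hGZK`, `hKo`, `hmod`}.
[cite: Jetchev2008, Cor. 1.5 (p. 812)] [cite: SerreAbelianLadic1968, Ch. IV §3.4 Lemma 3 (IV-23)] [cite: Elkies2006, Introduction (p. 1)] -/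
theorem bsdp_of_carrierNeCertificate_level_three_of_frobenius_of_swapLiterature
    (hPT : ∀ (K : Type) [Field K] [NumberField K], poitouTate_selmerStructure_duality_conj K)
    (hF1 : Gross1991_heegnerPoint_sub_ratTorsion_mem_E0)
    (h372 : GrossLMS1991.prop37_2_frobeniusCongruence)
    (hGZK : rank_eq_analyticRank_of_analyticRank_le_one)
    (hKo : ∀ (N : ℕ) [NeZero N] (W : WeierstrassCurve ℚ) (K : Type) [Field K] [NumberField K],
      kolyvagin N W K)
    (hmod : exists_isNewformOf)
    (W : WeierstrassCurve ℚ) [W.IsElliptic] [W.IsGloballyMinimal]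
    {N : ℕ} [NeZero N] {K : Type} [Field K] [NumberField K] (hK : IsImaginaryQuadratic K)
    (hD3 : NumberField.discr K ≠ -3) (hD4 : NumberField.discr K ≠ -4)
    (hH : SatisfiesHeegnerHypothesis N K) {P : (W.baseChange K).toAffine.Point}
    (hP : IsHeegnerPoint N W K P) (hnt : ¬ IsOfFinAddOrder P)
    (hsurj : W.HasSurjectiveModNGaloisRep 3)
    (ℓ : ℕ) [Fact ℓ.Prime] (hgood : W.HasGoodReductionAtPrime ℓ) (hℓ9 : ℓ % 9 = 2 ∨ ℓ % 9 = 5)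
    (ha9 : W.frobeniusTrace ℓ % 9 = 3 ∨ W.frobeniusTrace ℓ % 9 = 6)
    (q : ℕ) [Fact q.Prime] (hqN : q ∣ N) (hq3 : q ≠ 3)
    (hI : padicValNat 3 (AddSubgroup.zmultiples P).index ≤
      padicValNat 3 ((W.baseChange ℚ_[q]).localTamagawaNumber ℤ_[q]))
    (hr : W.analyticRank ≤ 1) {s : ℚ} (hs : shaAn W = (s : ℂ)) (hv : padicValRat 3 s = 0) :
    BSDp W 3 := by
  haveI : Fact (Nat.Prime 3) := ⟨by norm_num⟩
  exact bsdp_of_carrierNeCertificate_level_of_swapLiterature hPT hF1 h372 hGZK hKo hmod W 3 hK hD3 hD4 hH hP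
    hnt (by norm_num) (W.forall_hasSurjectiveModNGaloisRep_three_pow_of_frobenius hsurj ℓ hgood hℓ9 ha9) q hqN
    hq3 hI hr hs hv

/-- **`bsdp_of_jetRowCarrierNe_three_of_frobenius` re-keyed to named print only** (bucket A, `p = 3`, any reduction at `3`; irreducible + order-3 Frobenius ⇒ `ρ̄_{E,3}` onto, ONE mod-9 witness ⇒ tower; numeric front-end VERBATIM; consumer `…_level_three_of_frobenius_of_swapLiterature`). Displayed: {`hPT`, `hF1`, `h372`, `hGZK`, `hKo`, `hmod`}. [cite: Jetchev2008, Cor. 1.5 (p. 812)] [cite: SerreAbelianLadic1968, Ch. IV §3.4 Lemma 3 (IV-23)] -/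
theorem bsdp_of_jetRowCarrierNe_three_of_frobenius_of_swapLiterature
    (a1 a2 a3 a4 a6 : ℤ)
    (h0 : discOf [a1, a2, a3, a4, a6] ≠ 0) (bad : List (ℕ × ℕ × ℕ)) (hprime : ∀ t ∈ bad, t.1.Prime)
    (hsupp : (discOf [a1, a2, a3, a4, a6]).natAbs = (bad.map fun t => t.1 ^ t.2.2).prod)
    (hmin : ∀ t ∈ bad,
      (¬ (t.1 : ℤ) ^ 12 ∣ discOf [a1, a2, a3, a4, a6] ∨ ¬ (t.1 : ℤ) ^ 4 ∣ c4Of [a1, a2, a3, a4, a6]) ∨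
      (t.1 = 2 ∧ (16 : ℤ) ∣ c4Of [a1, a2, a3, a4, a6] ∧ (64 : ℤ) ∣ c6Of [a1, a2, a3, a4, a6] ∧
        ¬ (((16 : ℤ) ∣ c4Of [a1, a2, a3, a4, a6] / 16 ∧
            ((32 : ℤ) ∣ c6Of [a1, a2, a3, a4, a6] / 64 ∨ (32 : ℤ) ∣ c6Of [a1, a2, a3, a4, a6] / 64 - 8)) ∨
          (4 : ℤ) ∣ c6Of [a1, a2, a3, a4, a6] / 64 + 1)) ∨
      (t.1 = 3 ∧ (3 : ℤ) ^ 8 ∣ c6Of [a1, a2, a3, a4, a6] ∧ ¬ (3 : ℤ) ^ 9 ∣ c6Of [a1, a2, a3, a4, a6]))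
    (ℓ₁ ℓ₂ ℓ₃ : ℕ) (hℓ₁ : ℓ₁.Prime) (hℓ₂ : ℓ₂.Prime) (hℓ₃ : ℓ₃.Prime)
    (h2ℓ₁ : ℓ₁ ≠ 2) (h2ℓ₂ : ℓ₂ ≠ 2) (h2ℓ₃ : ℓ₃ ≠ 2) (h3ℓ₁ : ℓ₁ ≠ 3) (h3ℓ₂ : ℓ₂ ≠ 3)
    (hΔ₁ : ¬ (ℓ₁ : ℤ) ∣ (⟨a1, a2, a3, a4, a6⟩ : WeierstrassCurve ℤ).Δ)
    (hΔ₂ : ¬ (ℓ₂ : ℤ) ∣ (⟨a1, a2, a3, a4, a6⟩ : WeierstrassCurve ℤ).Δ)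
    (hΔ₃ : ¬ (ℓ₃ : ℤ) ∣ (⟨a1, a2, a3, a4, a6⟩ : WeierstrassCurve ℤ).Δ)
    {n₁ n₂ n₃ : ℕ} (hc₁ : countPoints [a1, a2, a3, a4, a6] ℓ₁ = n₁)
    (hc₂ : countPoints [a1, a2, a3, a4, a6] ℓ₂ = n₂) (hc₃ : countPoints [a1, a2, a3, a4, a6] ℓ₃ = n₃)
    (hi : ∀ c : ZMod 3, c ^ 2 - (((ℓ₁ : ℤ) + 1 - n₁ : ℤ) : ZMod 3) * c + ℓ₁ ≠ 0)
    (hii : (ℓ₂ : ZMod 3) = 1 ∧ (((ℓ₂ : ℤ) + 1 - n₂ : ℤ) : ZMod 3) = 2 ∧ ¬ 9 ∣ n₂)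
    (hiii : (ℓ₃ % 9 = 2 ∨ ℓ₃ % 9 = 5) ∧
      (((ℓ₃ : ℤ) + 1 - n₃) % 9 = 3 ∨ ((ℓ₃ : ℤ) + 1 - n₃) % 9 = 6))
    (hPT : ∀ (K : Type) [Field K] [NumberField K], poitouTate_selmerStructure_duality_conj K)
    (hF1 : Gross1991_heegnerPoint_sub_ratTorsion_mem_E0)
    (h372 : GrossLMS1991.prop37_2_frobeniusCongruence)
    (hGZK : rank_eq_analyticRank_of_analyticRank_le_one)
    (hKo : ∀ (N : ℕ) [NeZero N] (W : WeierstrassCurve ℚ) (K : Type) [Field K] [NumberField K],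
      kolyvagin N W K)
    (hmod : exists_isNewformOf)
    (W : WeierstrassCurve ℚ) (hW : W = ⟨a1, a2, a3, a4, a6⟩)
    {N : ℕ} [NeZero N] {K : Type} [Field K] [NumberField K] (hK : IsImaginaryQuadratic K)
    (hD3 : NumberField.discr K ≠ -3) (hD4 : NumberField.discr K ≠ -4)
    (hH : SatisfiesHeegnerHypothesis N K) {P : (W.baseChange K).toAffine.Point}
    (hP : IsHeegnerPoint N W K P) (hnt : ¬ IsOfFinAddOrder P)
    (q : ℕ) (hq : q.Prime) (hqN : q ∣ N) (hq3 : q ≠ 3)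
    (hI : (haveI := Fact.mk hq;
      padicValNat 3 (AddSubgroup.zmultiples P).index ≤
        padicValNat 3 ((W.baseChange ℚ_[q]).localTamagawaNumber ℤ_[q])))
    (hr : W.analyticRank ≤ 1) {s : ℚ} (hs : shaAn W = (s : ℂ)) (hv : padicValRat 3 s = 0) :
    BSDp W 3 := by
  subst hW
  haveI hE : (⟨a1, a2, a3, a4, a6⟩ : WeierstrassCurve ℚ).IsElliptic :=
    X11b.isElliptic_of_discOf_ne_zero a1 a2 a3 a4 a6 h0
  haveI hM : (⟨a1, a2, a3, a4, a6⟩ : WeierstrassCurve ℚ).IsGloballyMinimal :=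
    X11b.isGloballyMinimal_of_krausCriterion_support a1 a2 a3 a4 a6 bad hprime hsupp hmin
  haveI := Fact.mk hℓ₁; haveI := Fact.mk hℓ₂; haveI := Fact.mk hℓ₃; haveI := Fact.mk hq
  have hI0 : integralModelInt (⟨a1, a2, a3, a4, a6⟩ : WeierstrassCurve ℚ) = ⟨a1, a2, a3, a4, a6⟩ :=
    integralModelInt_eq_of_map_eq _ (map_mk_int a1 a2 a3 a4 a6)
  -- the three witness counts in `Nat.card` form
  have hn₁ : Nat.card (((⟨a1, a2, a3, a4, a6⟩ : WeierstrassCurve ℤ).map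
      (Int.castRingHom (ZMod ℓ₁))).toAffine.Point) = n₁ := by
    exact_mod_cast (X11b.natCard_point_eq_countPoints a1 a2 a3 a4 a6 ℓ₁ h2ℓ₁ hΔ₁).trans hc₁
  have hn₂ : Nat.card (((⟨a1, a2, a3, a4, a6⟩ : WeierstrassCurve ℤ).map
      (Int.castRingHom (ZMod ℓ₂))).toAffine.Point) = n₂ := by
    exact_mod_cast (X11b.natCard_point_eq_countPoints a1 a2 a3 a4 a6 ℓ₂ h2ℓ₂ hΔ₂).trans hc₂
  have hn₃ : Nat.card (((⟨a1, a2, a3, a4, a6⟩ : WeierstrassCurve ℤ).map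
      (Int.castRingHom (ZMod ℓ₃))).toAffine.Point) = n₃ := by
    exact_mod_cast (X11b.natCard_point_eq_countPoints a1 a2 a3 a4 a6 ℓ₃ h2ℓ₃ hΔ₃).trans hc₃
  -- `ρ̄_{E,3}` onto: irreducible Frobenius at `ℓ₁`, Frobenius of order `3` at `ℓ₂`
  have hsurj : (⟨a1, a2, a3, a4, a6⟩ : WeierstrassCurve ℚ).HasSurjectiveModNGaloisRep 3 :=
    GaloisImage.hasSurjectiveModNGaloisRep_of_intModel_of_irr_of_order hI0 3 ℓ₁ ℓ₂ h3ℓ₁ h3ℓ₂ hΔ₁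
      hΔ₂ hn₁ hn₂ hi hii.1 hii.2.1 (by norm_num; exact hii.2.2)
  -- the mod-`9` witness at `ℓ₃`: good reduction and `a_{ℓ₃} = ℓ₃ + 1 − n₃`
  have hgood₃ : (⟨a1, a2, a3, a4, a6⟩ : WeierstrassCurve ℚ).HasGoodReductionAtPrime ℓ₃ :=
    hasGoodReductionAtPrime_of_not_dvd _ ℓ₃ (by rw [minimalDiscriminantInt_eq hI0]; exact hΔ₃)
  have ha9 : (⟨a1, a2, a3, a4, a6⟩ : WeierstrassCurve ℚ).frobeniusTrace ℓ₃ % 9 = 3 ∨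
      (⟨a1, a2, a3, a4, a6⟩ : WeierstrassCurve ℚ).frobeniusTrace ℓ₃ % 9 = 6 := by
    rw [frobeniusTrace_eq hI0 hn₃]; exact hiii.2
  exact bsdp_of_carrierNeCertificate_level_three_of_frobenius_of_swapLiterature hPT hF1 h372 hGZK hKo hmod _ hK
    hD3 hD4 hH hP hnt hsurj ℓ₃ hgood₃ hiii.1 ha9 q hqN hq3 hI hr hs hv

/-! ## §1 The `JET/` record kits at `p = 3` not yet re-keyed -/

/-- **`bsdp_of_jetRowA3F_tamX_min` re-keyed to named print only** (road F, `p = 3`, any reduction at `3`, exact `TamX` certificate at the carrier; numeric front-end VERBATIM; consumer `…Ne…_level_of_swapLiterature` with the mod-9 tower). Displayed: {`hPT`, `hF1`, `h372`, `hGZK`, `hKo`, `hmod`}. CONDITIONAL on every binder; per pair. [cite: Jetchev2008, Cor. 1.5 (p. 812)] [cite: SerreAbelianLadic1968, Ch. IV §3.4 Lemma 3 (IV-23)] [cite: SilvermanATAEC1994, IV.9.4 Steps 5 and 8] -/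
theorem bsdp_of_jetRowA3F_tamX_min_of_swapLiterature (a1 a2 a3 a4 a6 : ℤ)
    (hmin : (⟨a1, a2, a3, a4, a6⟩ : WeierstrassCurve ℚ).IsGloballyMinimal)
    (ℓ₁ ℓ₂ : ℕ) (hℓ₁ : ℓ₁.Prime) (hℓ₂ : ℓ₂.Prime) (h2₁ : ℓ₁ ≠ 2) (h2₂ : ℓ₂ ≠ 2)
    (h3₁ : ℓ₁ ≠ 3) (h3₂ : ℓ₂ ≠ 3)
    (hΔ₁ : ¬ (ℓ₁ : ℤ) ∣ discOf [a1, a2, a3, a4, a6]) (hΔ₂ : ¬ (ℓ₂ : ℤ) ∣ discOf [a1, a2, a3, a4, a6])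
    {n₁ n₂ : ℕ} (hc₁ : countPoints [a1, a2, a3, a4, a6] ℓ₁ = n₁)
    (hc₂ : countPoints [a1, a2, a3, a4, a6] ℓ₂ = n₂)
    (hirr : ∀ t : ZMod 3, t ^ 2 - (((ℓ₁ : ℤ) + 1 - n₁ : ℤ) : ZMod 3) * t + ℓ₁ ≠ 0)
    (hdet₂ : (ℓ₂ : ZMod 3) = 1) (htr₂ : (((ℓ₂ : ℤ) + 1 - n₂ : ℤ) : ZMod 3) = 2) (hsq : ¬ 9 ∣ n₂)
    (ℓ₉ : ℕ) (hℓ₉ : ℓ₉.Prime) (h2₉ : ℓ₉ ≠ 2)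
    (hΔ₉ : ¬ (ℓ₉ : ℤ) ∣ (⟨a1, a2, a3, a4, a6⟩ : WeierstrassCurve ℤ).Δ)
    {n₉ : ℕ} (hc₉ : countPoints [a1, a2, a3, a4, a6] ℓ₉ = n₉)
    (hℓ9 : ℓ₉ % 9 = 2 ∨ ℓ₉ % 9 = 5)
    (ha9 : ((ℓ₉ : ℤ) + 1 - n₉) % 9 = 3 ∨ ((ℓ₉ : ℤ) + 1 - n₉) % 9 = 6)
    (q : ℕ) (hq : q.Prime) (F : TamX) (hFq : F.p = q) (hF : F.check ⟨a1, a2, a3, a4, a6⟩ = true)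
    {w : ℕ} (hw : w ≤ padicValNat 3 F.c) (hq3 : q ≠ 3)
    (hPT : ∀ (K : Type) [Field K] [NumberField K], poitouTate_selmerStructure_duality_conj K)
    (hF1 : Gross1991_heegnerPoint_sub_ratTorsion_mem_E0)
    (h372 : GrossLMS1991.prop37_2_frobeniusCongruence)
    (hGZK : rank_eq_analyticRank_of_analyticRank_le_one)
    (hKo : ∀ (N : ℕ) [NeZero N] (W : WeierstrassCurve ℚ) (K : Type) [Field K] [NumberField K], kolyvagin N W K)
    (hmod : exists_isNewformOf)
    (W : WeierstrassCurve ℚ) (hW : W = ⟨a1, a2, a3, a4, a6⟩)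
    {N : ℕ} [NeZero N] {K : Type} [Field K] [NumberField K] (hK : IsImaginaryQuadratic K)
    (hD3 : NumberField.discr K ≠ -3) (hD4 : NumberField.discr K ≠ -4)
    (hH : SatisfiesHeegnerHypothesis N K) {P : (W.baseChange K).toAffine.Point}
    (hP : IsHeegnerPoint N W K P) (hnt : ¬ IsOfFinAddOrder P) (hqN : q ∣ N)
    (hv : padicValNat 3 (AddSubgroup.zmultiples P).index ≤ w)
    (hr : W.analyticRank ≤ 1) {s : ℚ} (hs : shaAn W = (s : ℂ)) (hvs : padicValRat 3 s = 0) :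
    BSDp W 3 := by
  subst hW
  have h0 : discOf [a1, a2, a3, a4, a6] ≠ 0 := fun h ↦ hΔ₁ (by rw [h]; exact dvd_zero _)
  haveI hE : (⟨a1, a2, a3, a4, a6⟩ : WeierstrassCurve ℚ).IsElliptic :=
    X11b.isElliptic_of_discOf_ne_zero a1 a2 a3 a4 a6 h0
  haveI := hmin
  haveI : Fact (Nat.Prime 3) := ⟨by norm_num⟩
  haveI : Fact (Nat.Prime q) := ⟨hq⟩
  haveI := Fact.mk hℓ₉
  have hI0 : integralModelInt (⟨a1, a2, a3, a4, a6⟩ : WeierstrassCurve ℚ) = ⟨a1, a2, a3, a4, a6⟩ :=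
    integralModelInt_eq_of_map_eq _ (map_mk_int a1 a2 a3 a4 a6)
  have hρ : Surj (⟨a1, a2, a3, a4, a6⟩ : WeierstrassCurve ℚ) 3 :=
    Supersingular.surj_three_of_ainvs_of_irr_of_order a1 a2 a3 a4 a6 hmin ℓ₁ ℓ₂ hℓ₁ hℓ₂ h2₁ h2₂ h3₁ h3₂
      hΔ₁ hΔ₂ hc₁ hc₂ hirr hdet₂ htr₂ hsq
  have hn₉ : Nat.card (((⟨a1, a2, a3, a4, a6⟩ : WeierstrassCurve ℤ).map
      (Int.castRingHom (ZMod ℓ₉))).toAffine.Point) = n₉ := by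
    exact_mod_cast (X11b.natCard_point_eq_countPoints a1 a2 a3 a4 a6 ℓ₉ h2₉ hΔ₉).trans hc₉
  have htower : ∀ n : ℕ, (⟨a1, a2, a3, a4, a6⟩ : WeierstrassCurve ℚ).HasSurjectiveModNGaloisRep (3 ^ n : ℕ) :=
    GaloisImage.forall_hasSurjectiveModNGaloisRep_three_pow_of_intModel_of_frobenius hI0 hρ ℓ₉ hΔ₉ hn₉ hℓ9
      ha9
  -- the Tamagawa half in the kernel: `c_q(W/ℚ_q) = F.c` (exact IV / IV* certificate)
  have hcq : ((⟨a1, a2, a3, a4, a6⟩ : WeierstrassCurve ℚ).baseChange ℚ_[q]).localTamagawaNumber ℤ_[q] = F.c :=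
    Additive.IntModelTam.localTamagawaNumber_padic_eq_of_intModel_of_tamX hI0 q hFq hF
  have hI : padicValNat 3 (AddSubgroup.zmultiples P).index ≤ padicValNat 3
      (((⟨a1, a2, a3, a4, a6⟩ : WeierstrassCurve ℚ).baseChange ℚ_[q]).localTamagawaNumber ℤ_[q]) := hcq ▸ hv.trans hw
  exact bsdp_of_carrierNeCertificate_level_of_swapLiterature hPT hF1 h372 hGZK hKo hmod _ 3 hK hD3 hD4 hH hP hnt
    (by decide) htower q hqN hq3 hI hr hs hvs

/-- **`bsdp_of_jetRowA3_tam_min` re-keyed to named print only** (bucket A, `3` multiplicative at `3`, carrier `q ≠ 3` by a `TamLocal` certificate; numeric front-end VERBATIM; consumer `…Ne…_level_of_mult_of_swapLiterature`). Displayed: {`hPT`, `hF1`, `h372`, `hGZK`, `hKo`, `hmod`}. [cite: Jetchev2008, Cor. 1.5 (p. 812)] [cite: Serre1972, §2.4 Prop. 15] [cite: Wuthrich2014, Lemma 20 (p. 399)] -/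
theorem bsdp_of_jetRowA3_tam_min_of_swapLiterature (a1 a2 a3 a4 a6 : ℤ)
    (hmin : (⟨a1, a2, a3, a4, a6⟩ : WeierstrassCurve ℚ).IsGloballyMinimal)
    (h3Δ : (3 : ℤ) ∣ (⟨a1, a2, a3, a4, a6⟩ : WeierstrassCurve ℤ).Δ)
    (h3c₄ : ¬ (3 : ℤ) ∣ (⟨a1, a2, a3, a4, a6⟩ : WeierstrassCurve ℤ).c₄)
    (ℓ₁ ℓ₂ : ℕ) (hℓ₁ : ℓ₁.Prime) (hℓ₂ : ℓ₂.Prime) (h2₁ : ℓ₁ ≠ 2) (h2₂ : ℓ₂ ≠ 2)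
    (h3₁ : ℓ₁ ≠ 3) (h3₂ : ℓ₂ ≠ 3)
    (hΔ₁ : ¬ (ℓ₁ : ℤ) ∣ discOf [a1, a2, a3, a4, a6]) (hΔ₂ : ¬ (ℓ₂ : ℤ) ∣ discOf [a1, a2, a3, a4, a6])
    {n₁ n₂ : ℕ} (hc₁ : countPoints [a1, a2, a3, a4, a6] ℓ₁ = n₁)
    (hc₂ : countPoints [a1, a2, a3, a4, a6] ℓ₂ = n₂)
    (hirr : ∀ t : ZMod 3, t ^ 2 - (((ℓ₁ : ℤ) + 1 - n₁ : ℤ) : ZMod 3) * t + ℓ₁ ≠ 0)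
    (hdet₂ : (ℓ₂ : ZMod 3) = 1) (htr₂ : (((ℓ₂ : ℤ) + 1 - n₂ : ℤ) : ZMod 3) = 2) (hsq : ¬ 9 ∣ n₂)
    (q : ℕ) (T : TamLocal) (hTq : T.p = q) (hT : T.check ⟨a1, a2, a3, a4, a6⟩ = true)
    {c : ℕ} (hvals : T.vals = [c]) {w : ℕ} (hw : w ≤ padicValNat 3 c) (hq3 : q ≠ 3)
    (hPT : ∀ (K : Type) [Field K] [NumberField K], poitouTate_selmerStructure_duality_conj K)
    (hF1 : Gross1991_heegnerPoint_sub_ratTorsion_mem_E0)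
    (h372 : GrossLMS1991.prop37_2_frobeniusCongruence)
    (hGZK : rank_eq_analyticRank_of_analyticRank_le_one)
    (hKo : ∀ (N : ℕ) [NeZero N] (W : WeierstrassCurve ℚ) (K : Type) [Field K] [NumberField K], kolyvagin N W K)
    (hmod : exists_isNewformOf)
    (W : WeierstrassCurve ℚ) (hW : W = ⟨a1, a2, a3, a4, a6⟩)
    {N : ℕ} [NeZero N] {K : Type} [Field K] [NumberField K] (hK : IsImaginaryQuadratic K)
    (hD3 : NumberField.discr K ≠ -3) (hD4 : NumberField.discr K ≠ -4)
    (hH : SatisfiesHeegnerHypothesis N K) {P : (W.baseChange K).toAffine.Point}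
    (hP : IsHeegnerPoint N W K P) (hnt : ¬ IsOfFinAddOrder P) (hqN : q ∣ N)
    (hv : padicValNat 3 (AddSubgroup.zmultiples P).index ≤ w)
    (hr : W.analyticRank ≤ 1) {s : ℚ} (hs : shaAn W = (s : ℂ)) (hvs : padicValRat 3 s = 0) :
    BSDp W 3 := by
  subst hW
  have h0 : discOf [a1, a2, a3, a4, a6] ≠ 0 := fun h ↦ hΔ₁ (by rw [h]; exact dvd_zero _)
  haveI hE : (⟨a1, a2, a3, a4, a6⟩ : WeierstrassCurve ℚ).IsElliptic :=
    X11b.isElliptic_of_discOf_ne_zero a1 a2 a3 a4 a6 h0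
  haveI := hmin
  haveI : Fact (Nat.Prime 3) := ⟨by norm_num⟩
  haveI : Fact (Nat.Prime q) := ⟨hTq ▸ (TamLocal.check_common hT).1⟩
  have hI0 : integralModelInt (⟨a1, a2, a3, a4, a6⟩ : WeierstrassCurve ℚ) = ⟨a1, a2, a3, a4, a6⟩ :=
    integralModelInt_eq_of_map_eq _ (map_mk_int a1 a2 a3 a4 a6)
  -- `ρ̄_{E,3}` onto from the two Frobenius witnesses (irreducible + order 3)
  have hρ : Surj (⟨a1, a2, a3, a4, a6⟩ : WeierstrassCurve ℚ) 3 :=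
    Supersingular.surj_three_of_ainvs_of_irr_of_order a1 a2 a3 a4 a6 hmin ℓ₁ ℓ₂ hℓ₁ hℓ₂ h2₁ h2₂ h3₁ h3₂
      hΔ₁ hΔ₂ hc₁ hc₂ hirr hdet₂ htr₂ hsq
  -- multiplicative at `3`
  have hmult : (⟨a1, a2, a3, a4, a6⟩ : WeierstrassCurve ℚ).HasMultiplicativeReductionAtPrime 3 :=
    hasMultiplicativeReductionAtPrime_of_intModel hI0 3 h3Δ h3c₄
  -- the Tamagawa half in the kernel: `c_q(W/ℚ_q) = c`
  have hcq : ((⟨a1, a2, a3, a4, a6⟩ : WeierstrassCurve ℚ).baseChange ℚ_[q]).localTamagawaNumber ℤ_[q] = c :=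
    Additive.IntModelTam.localTamagawaNumber_padic_eq_of_intModel_of_tamLocal hI0 q hTq hT hvals
  have hI : padicValNat 3 (AddSubgroup.zmultiples P).index ≤ padicValNat 3
      (((⟨a1, a2, a3, a4, a6⟩ : WeierstrassCurve ℚ).baseChange ℚ_[q]).localTamagawaNumber ℤ_[q]) := hcq ▸ hv.trans hw
  exact bsdp_of_carrierNeCertificate_level_of_mult_of_swapLiterature hPT hF1 h372 hGZK hKo hmod _ 3 hK hD3 hD4 hH hP hnt
    (by decide) hmult hρ q hqN hq3 hI hr hs hvs

/-- **`bsdp_of_jetRowA3_tamX_min` re-keyed to named print only** (as `A3_tam` with an exact `TamX` certificate at an additive IV/IV* carrier). Displayed: {`hPT`, `hF1`, `h372`, `hGZK`, `hKo`, `hmod`}. [cite: Jetchev2008, Cor. 1.5 (p. 812)] [cite: SilvermanATAEC1994, IV.9.4 Steps 5 and 8] -/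
theorem bsdp_of_jetRowA3_tamX_min_of_swapLiterature (a1 a2 a3 a4 a6 : ℤ)
    (hmin : (⟨a1, a2, a3, a4, a6⟩ : WeierstrassCurve ℚ).IsGloballyMinimal)
    (h3Δ : (3 : ℤ) ∣ (⟨a1, a2, a3, a4, a6⟩ : WeierstrassCurve ℤ).Δ)
    (h3c₄ : ¬ (3 : ℤ) ∣ (⟨a1, a2, a3, a4, a6⟩ : WeierstrassCurve ℤ).c₄)
    (ℓ₁ ℓ₂ : ℕ) (hℓ₁ : ℓ₁.Prime) (hℓ₂ : ℓ₂.Prime) (h2₁ : ℓ₁ ≠ 2) (h2₂ : ℓ₂ ≠ 2)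
    (h3₁ : ℓ₁ ≠ 3) (h3₂ : ℓ₂ ≠ 3)
    (hΔ₁ : ¬ (ℓ₁ : ℤ) ∣ discOf [a1, a2, a3, a4, a6]) (hΔ₂ : ¬ (ℓ₂ : ℤ) ∣ discOf [a1, a2, a3, a4, a6])
    {n₁ n₂ : ℕ} (hc₁ : countPoints [a1, a2, a3, a4, a6] ℓ₁ = n₁)
    (hc₂ : countPoints [a1, a2, a3, a4, a6] ℓ₂ = n₂)
    (hirr : ∀ t : ZMod 3, t ^ 2 - (((ℓ₁ : ℤ) + 1 - n₁ : ℤ) : ZMod 3) * t + ℓ₁ ≠ 0)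
    (hdet₂ : (ℓ₂ : ZMod 3) = 1) (htr₂ : (((ℓ₂ : ℤ) + 1 - n₂ : ℤ) : ZMod 3) = 2) (hsq : ¬ 9 ∣ n₂)
    (q : ℕ) (hq : q.Prime) (F : TamX) (hFq : F.p = q) (hF : F.check ⟨a1, a2, a3, a4, a6⟩ = true)
    {w : ℕ} (hw : w ≤ padicValNat 3 F.c) (hq3 : q ≠ 3)
    (hPT : ∀ (K : Type) [Field K] [NumberField K], poitouTate_selmerStructure_duality_conj K)
    (hF1 : Gross1991_heegnerPoint_sub_ratTorsion_mem_E0)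
    (h372 : GrossLMS1991.prop37_2_frobeniusCongruence)
    (hGZK : rank_eq_analyticRank_of_analyticRank_le_one)
    (hKo : ∀ (N : ℕ) [NeZero N] (W : WeierstrassCurve ℚ) (K : Type) [Field K] [NumberField K], kolyvagin N W K)
    (hmod : exists_isNewformOf)
    (W : WeierstrassCurve ℚ) (hW : W = ⟨a1, a2, a3, a4, a6⟩)
    {N : ℕ} [NeZero N] {K : Type} [Field K] [NumberField K] (hK : IsImaginaryQuadratic K)
    (hD3 : NumberField.discr K ≠ -3) (hD4 : NumberField.discr K ≠ -4)
    (hH : SatisfiesHeegnerHypothesis N K) {P : (W.baseChange K).toAffine.Point}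
    (hP : IsHeegnerPoint N W K P) (hnt : ¬ IsOfFinAddOrder P) (hqN : q ∣ N)
    (hv : padicValNat 3 (AddSubgroup.zmultiples P).index ≤ w)
    (hr : W.analyticRank ≤ 1) {s : ℚ} (hs : shaAn W = (s : ℂ)) (hvs : padicValRat 3 s = 0) :
    BSDp W 3 := by
  subst hW
  have h0 : discOf [a1, a2, a3, a4, a6] ≠ 0 := fun h ↦ hΔ₁ (by rw [h]; exact dvd_zero _)
  haveI hE : (⟨a1, a2, a3, a4, a6⟩ : WeierstrassCurve ℚ).IsElliptic :=
    X11b.isElliptic_of_discOf_ne_zero a1 a2 a3 a4 a6 h0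
  haveI := hmin
  haveI : Fact (Nat.Prime 3) := ⟨by norm_num⟩
  haveI : Fact (Nat.Prime q) := ⟨hq⟩
  have hI0 : integralModelInt (⟨a1, a2, a3, a4, a6⟩ : WeierstrassCurve ℚ) = ⟨a1, a2, a3, a4, a6⟩ :=
    integralModelInt_eq_of_map_eq _ (map_mk_int a1 a2 a3 a4 a6)
  have hρ : Surj (⟨a1, a2, a3, a4, a6⟩ : WeierstrassCurve ℚ) 3 :=
    Supersingular.surj_three_of_ainvs_of_irr_of_order a1 a2 a3 a4 a6 hmin ℓ₁ ℓ₂ hℓ₁ hℓ₂ h2₁ h2₂ h3₁ h3₂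
      hΔ₁ hΔ₂ hc₁ hc₂ hirr hdet₂ htr₂ hsq
  have hmult : (⟨a1, a2, a3, a4, a6⟩ : WeierstrassCurve ℚ).HasMultiplicativeReductionAtPrime 3 :=
    hasMultiplicativeReductionAtPrime_of_intModel hI0 3 h3Δ h3c₄
  -- the Tamagawa half in the kernel: `c_q(W/ℚ_q) = F.c` (exact IV / IV* certificate)
  have hcq : ((⟨a1, a2, a3, a4, a6⟩ : WeierstrassCurve ℚ).baseChange ℚ_[q]).localTamagawaNumber ℤ_[q] = F.c :=
    Additive.IntModelTam.localTamagawaNumber_padic_eq_of_intModel_of_tamX hI0 q hFq hF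
  have hI : padicValNat 3 (AddSubgroup.zmultiples P).index ≤ padicValNat 3
      (((⟨a1, a2, a3, a4, a6⟩ : WeierstrassCurve ℚ).baseChange ℚ_[q]).localTamagawaNumber ℤ_[q]) := hcq ▸ hv.trans hw
  exact bsdp_of_carrierNeCertificate_level_of_mult_of_swapLiterature hPT hF1 h372 hGZK hKo hmod _ 3 hK hD3 hD4 hH hP hnt
    (by decide) hmult hρ q hqN hq3 hI hr hs hvs

end Summit.BirchSwinnertonDyer.Rank1Residual.JET

end
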